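import Summits.BirchSwinnertonDyer.BirchSwinnertonDyer.Theorems.SylvesterTwoHeegnerIndexCMDataDerivative
import Literature.NumberTheory.EllipticCurves.GeomPointsEmbeddingDescent
import Literature.NumberTheory.EllipticCurves.HuShuYin2019.SylvesterRingClassCubeRoots
import Literature.NumberTheory.EllipticCurves.HuShuYin2019.SylvesterTowerTwoTorsion
import Literature.NumberTheory.EllipticCurves.HuShuYin2019.SylvesterNineMinimalModel
import HarnessLib

/-!
# DATA LAYER (R-c) of leaf (L1), crux `UpperOffV0HSYPlus` (stmt-BirchSwinnertonDyer-19804): the `K̄`-level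
# input package of the recipe R0 `HuShuYin2019.exists_cmFrame_kolyvaginClass` at ONE Kolyvagin prime —
# `emb`, `N ⊴ Γ_K`, `N ≤ N'`, `P = D_ℓ y_ℓ ∈ E(K̄)^N`, `hP`, `hN'c`, `h6`, `t/ht`

Skeleton of record VARIANT M (`Cruxes/UpperOffV0HSYPlus/Lines/coupled_variantM.lean` 406ca288e244d392),
line card v24, residual (R): the class TERMS `c_A(ℓ) = kolyvaginClass … (ψ (Σᵢ ρ(tᵢ)(tᵢ • P))) hQ'` of
leaf (L1) come from R0 once its DATA inputs exist.  With #R-a (rationality, p656863) and #R-b (Gross 3.6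
at the finite level) this file assembles them, for every model `W/ℚ`, every `Dt : ModularParametrizationData
W 243` and the level `9pℓ` (one Kolyvagin prime `ℓ ≡ 2 (3)`), by ONE CALL EACH of k-ty1's bridge
`GeomPointsEmbeddingDescent` (p622063), `SylvesterRingClassCubeRoots` (p638439) and
`SylvesterTowerTwoTorsion` (p616953):

* `exists_emb_ringClassField` — an embedding `emb : K[m] → K̄` over `K` EXISTS (`IsAlgClosed.lift`);
* `map_emb_mem_fixedPoints` — `ι_emb(E(K[m])) ⊆ E(K̄)^N` for `N = Gal(K̄/emb K[m])` (`hPN`);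
* `exists_fixedPoints_zsmul_eq_smul_map_derivOp_sub` — **R0's `hP`**: for `N' = Gal(K̄/emb(K[9pℓ] ∩ K[9p]))`
  (any `N'` with `g ∈ N' ↔ g` fixes `emb x` for `(x : ℂ) ∈ K[9p]`), every `h ∈ N'` moves
  `P = ι_emb(D_ℓ y_ℓ)` inside `2^M · E(K̄)^N` (#R-b's `hfin` through `exists_fixedPoints_zsmul_eq_of_finite_level`);
* `le_of_mem_iff_of_mem_iff_forall` — `N ≤ N'`;
* `forall_apply_eq_of_pow_three_eq_div_nine_of_fix_nine_mul`, `…_sq_div_three_…` — **R0's `hN'c`** for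
  `c = p/9` (`E_p = (E_9)^χ`) and `c = p²/3` (`E_{3p²}`): `N'` fixes every cube root of `c`
  (`∛(3p) ∈ K[9p]`, `forall_apply_eq_of_coe_pow_three_eq` along `emb ∘ (K[9p] ⊆ K[9pℓ])`);
* `pow_three_ne_six_of_fix_sylvester_prime` — **R0's `h6`** at `m = 9pℓ` (`p`, `ℓ` odd);
* `exists_transversal_quotient` — **R0's `t/ht`**: a finite system of representatives of `Γ_K/N'`
  lifted from `Aut(K[9pℓ]/K) / Gal(K[9pℓ]/K[9p])` (`bijective_quotient_of_finite_level`);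
* `mem_fixedPoints_symm_of_equivariant`, `exists_fixedPoints_zsmul_eq_symm_of_equivariant` — transport
  of `hPN`/`hP` along a `Γ_K`-equivariant `κ : E₉(K̄) ≃+ W(K̄)` (k-ty1 #16
  `exists_frameTransport_cubeSumCurve_nine` for `W₀ = ⟨0,0,1,0,−1⟩`), so that `P` lands in
  `geomPoints ((cubeSumCurve 9).baseChange K)` = R0's `E₉`.

HONEST FRAMING: theorems only (no definition, no named fact, no instance, no notation); assembly of PROVED
tree theorems; nothing about Selmer groups, `Ш`, the FLIP, the height display or BSD; no stub of VARIANT M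
closed; `--supports stmt-BirchSwinnertonDyer-19804 --as helper`.  NET: at the level `9pℓ` every input of
R0 except the curve-specific `(b, c, hb)` is a tree term or a one-call theorem; the TWO-prime level
`9pℓℓ'` (classes `c_B(ℓℓ')`) still needs `Gal(K[9pℓℓ']/K[9p]) ≤ closure {σ_ℓ, σ_ℓ'}`.

## References
* B. H. Gross, LMS LNS 153 (1991), §3 Prop. 3.6, §4 (4.1)–(4.4), Lemma 4.3. [GrossLMS1991]
* W. G. McCallum, same volume, §4 (4)–(6). [McCallumLMS1991]
* Y. Hu, J. Shu, H. Yin, Trans. AMS 372 (2019), arXiv 1708.05266 §2 Prop. 2.4, §4.1. [HuShuYin2019]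
* J. H. Silverman, *AEC*, GTM 106, VIII §1. [SilvermanAEC2009]

## Mathlib / tree search
Tree: `exists_subgroup_mem_iff`, `normal_of_mem_iff`, `embPoints_mem_fixedPoints`,
`exists_fixedPoints_zsmul_eq_of_finite_level`, `exists_subgroup_mem_iff_forall`, `exists_lift_algEquiv`,
`bijective_quotient_of_finite_level` (`GeomPointsEmbeddingDescent`); `forall_apply_eq_of_coe_pow_three_eq`,
`cubeRoot_three_mul_mem_ringClassField` (`SylvesterRingClassCubeRoots`, `RingClassFieldCubeRoots`);
`pow_three_ne_six_of_forall_apply_eq` (`SylvesterTowerTwoTorsion`); `RingClassField.inclusion`, `coe_inclusion`,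
`ringClassField_mono` (`RingClassFieldTower`); `JZero.mem_fixedPoints_iff`; Mathlib `IsAlgClosed.lift`.
`lean search 'exists_emb_ringClassField|exists_transversal_quotient'` → nothing before this file.
presearch: n/a (assembly of tree theorems; no new mathematics).
-/

set_option linter.dupNamespace false -- Summits modules are `Summit.<Summit>.<Problem>…` by design

noncomputable section

open scoped Classical

namespace Summit.BirchSwinnertonDyer.BirchSwinnertonDyer.Theorems.SylvesterTwoCMData

open Complex NumberField WeierstrassCurve
open Literature.NumberTheory.EllipticCurves Literature.NumberTheory.EllipticCurves.ModularForms
  Literature.NumberTheory.EllipticCurves.HuShuYin2019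
  Literature.NumberTheory.EllipticCurves.RingClassField

variable {K : Type} [Field K] [NumberField K]

/-! ### The embedding `emb : K[m] → K̄` over `K` -/

/-- **An embedding `K[m] → K̄` over `K` exists** (`K[m]/K` is algebraic — finite for `m ≠ 0` — and `K̄`
is algebraically closed: Mathlib `IsAlgClosed.lift`); the field `emb`/`emb_apply` of the tree's
`KolyvaginHeegnerData`, supplied. [cite: GrossLMS1991, §4 (4.2)] -/
theorem exists_emb_ringClassField (hK : IsImaginaryQuadratic K) (ι : K →+* ℂ) {m : ℕ} (hm : m ≠ 0) :
    ∃ emb : ringClassField K ι m →+* AlgebraicClosure K,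
      ∀ k : K, emb (algebraMap K (ringClassField K ι m) k) = algebraMap K (AlgebraicClosure K) k := by
  haveI := (finiteDimensional_and_isGalois_ringClassField hK ι hm).1
  haveI : Algebra.IsAlgebraic K (ringClassField K ι m) := Algebra.IsAlgebraic.of_finite K _
  let f : ringClassField K ι m →ₐ[K] AlgebraicClosure K := IsAlgClosed.lift
  exact ⟨f.toRingHom, fun k ↦ f.commutes k⟩

/-! ### `hPN`: points of `E(K[m])` are fixed by `N = Gal(K̄/emb K[m])` -/

/-- **`ι_emb(Q) ∈ E(K̄)^N`** for every `Q ∈ E(K[m])` and any `N ≤ Γ_K` with `g ∈ N ↔ g ∘ emb = emb`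
(`ι_emb = Affine.Point.map emb`): R0's `hPN` for `P := ι_emb(D_ℓ y_ℓ)`.
[cite: SilvermanAEC2009, VIII.§1] [cite: GrossLMS1991, §4 (4.2)] -/
theorem map_emb_mem_fixedPoints (W : WeierstrassCurve ℚ) (ι : K →+* ℂ) {m : ℕ}
    (emb : ringClassField K ι m →+* AlgebraicClosure K)
    (ιe : letI : DecidableEq (ringClassField K ι m) := fun a b ↦ Classical.propDecidable (a = b)
      (W.baseChange (ringClassField K ι m)).toAffine.Point →+ geomPoints (W.baseChange K))
    (hιe : ∀ P, ιe P = Affine.Point.map (W' := W) emb.toRatAlgHom P)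
    (N : Subgroup (Field.absoluteGaloisGroup K))
    (hN : ∀ g : Field.absoluteGaloisGroup K, g ∈ N ↔
      ∀ x : ringClassField K ι m, (show AlgebraicClosure K ≃ₐ[K] AlgebraicClosure K from g) (emb x) = emb x)
    (Q : (W.baseChange (ringClassField K ι m)).toAffine.Point) :
    ιe Q ∈ FixedPoints.addSubgroup N (geomPoints (W.baseChange K)) :=
  embPoints_mem_fixedPoints W emb ιe hιe N hN Q

omit [NumberField K] in
/-- **`N ≤ N'`**: the subgroup fixing `emb(K[m])` pointwise lies in the subgroup fixing `emb(S)` for any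
`S ⊆ K[m]`. [folklore] -/
theorem le_of_mem_iff_of_mem_iff_forall {L : Type} [Field L] (emb : L →+* AlgebraicClosure K)
    {N N' : Subgroup (Field.absoluteGaloisGroup K)}
    (hN : ∀ g : Field.absoluteGaloisGroup K, g ∈ N ↔
      ∀ x : L, (show AlgebraicClosure K ≃ₐ[K] AlgebraicClosure K from g) (emb x) = emb x)
    {S : Set L}
    (hN' : ∀ g : Field.absoluteGaloisGroup K, g ∈ N' ↔
      ∀ x ∈ S, (show AlgebraicClosure K ≃ₐ[K] AlgebraicClosure K from g) (emb x) = emb x) :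
    N ≤ N' :=
  fun g hg ↦ (hN' g).mpr fun x _ ↦ (hN g).mp hg x

/-! ### `hP`: the derived point is moved inside `2^M · E(K̄)^N` by `N' = Gal(K̄/K[9p])` -/

/-- **R0's `hP` at the level `9pℓ`.**  For `K` imaginary quadratic with `d_K = −3`, any `W/ℚ` with `Dt`
at level `243`, `p ≡ 1 (3)`, a Kolyvagin prime `ℓ ≡ 2 (3)` (`ℓ ∤ p`, `(ℓ)` inert), `2^M ∣ ℓ + 1`,
`2^M ∣ a_ℓ`, a generator `σ_ℓ` of `G_ℓ`, the CM points `y` (conductor `9pℓ`) and `y₀` (conductor `9p`)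
in `E(K[9pℓ])`, an embedding `emb : K[9pℓ] → K̄` over `K`, `N = Gal(K̄/emb K[9pℓ])` and ANY `N'` with
`g ∈ N' ↔ g` fixes `emb x` for all `x ∈ K[9pℓ]` with `(x : ℂ) ∈ K[9p]`: every `h ∈ N'` satisfies
`∃ a ∈ E(K̄)^N, 2^M • a = h • P − P` for `P = ι_emb(D_ℓ y)` — VERBATIM the binder `hP` of
`JZero.cubicTwist_chiComponent_fixedPoints_mem_invPoints` / `HuShuYin2019.exists_cmFrame_kolyvaginClass`
(Gross Prop. 3.6 + §4 descent). [cite: GrossLMS1991, §3 Prop. 3.6, §4 (4.1)–(4.4)] [cite: McCallumLMS1991, §4 (4)] -/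
theorem exists_fixedPoints_zsmul_eq_smul_map_derivOp_sub (hK : IsImaginaryQuadratic K)
    (hdK : NumberField.discr K = -3) (ι : K →+* ℂ) {W : WeierstrassCurve ℚ}
    (Dt : ModularParametrizationData W 243) {p ℓ : ℕ} (hp : p % 3 = 1) (hℓ : ℓ.Prime)
    (hℓ3 : ℓ % 3 = 2) (hℓp : ¬ ℓ ∣ p) (hinert : (Ideal.span {(ℓ : 𝓞 K)}).IsPrime) {M : ℕ}
    (hMℓ : 2 ^ M ∣ ℓ + 1) (hMa : ((2 ^ M : ℕ) : ℤ) ∣ W.LFunction ℓ)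
    {σ : ringClassField K ι (9 * p * ℓ) ≃ₐ[ℚ] ringClassField K ι (9 * p * ℓ)}
    (hσ : Subgroup.zpowers σ = ringClassGalOver ι (9 * p * ℓ) (9 * p))
    {y y₀ : (W.baseChange (ringClassField K ι (9 * p * ℓ))).toAffine.Point}
    (hy : Affine.Point.map (W' := W) (ringClassField K ι (9 * p * ℓ)).subtype.toRatAlgHom y =
      Dt.φ (heegnerTau ((ℓ : ℤ) ^ 2 * (81 * ((p : ℤ) ^ 2 + 4 * p + 16)),
        (ℓ : ℤ) * (-(9 * (4 * (p : ℤ) ^ 2 + 17 * p + 72))), 4 * (p : ℤ) ^ 2 + 18 * p + 81)))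
    (hy₀ : Affine.Point.map (W' := W) (ringClassField K ι (9 * p * ℓ)).subtype.toRatAlgHom y₀ =
      Dt.φ (heegnerTau (81 * ((p : ℤ) ^ 2 + 4 * p + 16), -(9 * (4 * (p : ℤ) ^ 2 + 17 * p + 72)),
        4 * (p : ℤ) ^ 2 + 18 * p + 81)))
    (emb : ringClassField K ι (9 * p * ℓ) →+* AlgebraicClosure K)
    (hemb : ∀ k : K, emb (algebraMap K (ringClassField K ι (9 * p * ℓ)) k) =
      algebraMap K (AlgebraicClosure K) k)
    (ιe : letI : DecidableEq (ringClassField K ι (9 * p * ℓ)) := fun a b ↦ Classical.propDecidable (a = b)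
      (W.baseChange (ringClassField K ι (9 * p * ℓ))).toAffine.Point →+ geomPoints (W.baseChange K))
    (hιe : ∀ P, ιe P = Affine.Point.map (W' := W) emb.toRatAlgHom P)
    (N : Subgroup (Field.absoluteGaloisGroup K))
    (hN : ∀ g : Field.absoluteGaloisGroup K, g ∈ N ↔
      ∀ x : ringClassField K ι (9 * p * ℓ),
        (show AlgebraicClosure K ≃ₐ[K] AlgebraicClosure K from g) (emb x) = emb x)
    (N' : Subgroup (Field.absoluteGaloisGroup K))
    (hN' : ∀ g : Field.absoluteGaloisGroup K, g ∈ N' ↔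
      ∀ x ∈ {x : ringClassField K ι (9 * p * ℓ) | (x : ℂ) ∈ ringClassField K ι (9 * p)},
        (show AlgebraicClosure K ≃ₐ[K] AlgebraicClosure K from g) (emb x) = emb x) :
    ∀ h ∈ N', ∃ a ∈ FixedPoints.addSubgroup N (geomPoints (W.baseChange K)),
      ((2 ^ M : ℕ) : ℤ) • a =
        h • ιe (KolyvaginOperator.derivOp (pointGalHom W (ringClassField K ι (9 * p * ℓ))) σ ℓ y) -
          ιe (KolyvaginOperator.derivOp (pointGalHom W (ringClassField K ι (9 * p * ℓ))) σ ℓ y) := by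
  intro h hh
  have hp0 : p ≠ 0 := by rintro rfl; simp at hp
  have hn0 : 9 * p * ℓ ≠ 0 := mul_ne_zero (mul_ne_zero (by norm_num) hp0) hℓ.ne_zero
  haveI := (finiteDimensional_and_isGalois_ringClassField hK ι hn0).2
  have key := exists_zsmul_eq_map_derivOp_sub_of_fix hK hdK ι Dt hp hℓ hℓ3 hℓp hinert hMℓ hMa hσ hy hy₀
  -- the bridge lemma is stated for the classical `DecidableEq` on `K[9pℓ]`; the group laws agree
  -- (`DecidableEq` is a subsingleton), which `convert` discharges
  refine exists_fixedPoints_zsmul_eq_of_finite_level W emb hemb ιe hιe N hN _ _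
    {x : ringClassField K ι (9 * p * ℓ) | (x : ℂ) ∈ ringClassField K ι (9 * p)} ?_ h ((hN' h).mp hh)
  intro τ hτ
  obtain ⟨a₀, ha₀⟩ := key τ hτ
  exact ⟨a₀, by convert ha₀⟩

/-! ### `hN'c`: `N'` fixes the cube roots of `p/9` and of `p²/3` -/

/-- `K[9p] ⊆ K[9pℓ]` as subfields of `ℂ`. [cite: GrossLMS1991, §3 (the tower K_m ⊂ K_n)] -/
theorem ringClassField_nine_mul_le (hK : IsImaginaryQuadratic K) (ι : K →+* ℂ) {p ℓ : ℕ} (hp0 : p ≠ 0)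
    (hℓ0 : ℓ ≠ 0) : ringClassField K ι (9 * p) ≤ ringClassField K ι (9 * p * ℓ) :=
  ringClassField_mono hK ι (dvd_mul_right (9 * p) ℓ) (mul_ne_zero (mul_ne_zero (by norm_num) hp0) hℓ0)

/-- **`N'` fixes every cube root of `c` in `K̄` once `z ∈ K[9p]` with `z³ = c`** (`N'` = any subgroup
fixing `emb x` for the `x ∈ K[9pℓ]` lying in `K[9p]`; the cube roots of `c` are `emb(ωⁱ z)`).
[cite: HuShuYin2019, §2 Prop. 2.4] [cite: Cox2013, §9.A] -/
theorem forall_apply_eq_of_coe_pow_three_eq_of_fix_nine_mul {ω : K} (hω : ω ^ 2 + ω + 1 = 0)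
    (h2 : Module.finrank ℚ K = 2) (ι : K →+* ℂ) {p ℓ : ℕ} (hp0 : p ≠ 0) (hℓ0 : ℓ ≠ 0)
    (emb : ringClassField K ι (9 * p * ℓ) →+* AlgebraicClosure K)
    (hemb : ∀ k : K, emb (algebraMap K (ringClassField K ι (9 * p * ℓ)) k) =
      algebraMap K (AlgebraicClosure K) k)
    (N' : Subgroup (Field.absoluteGaloisGroup K))
    (hN' : ∀ g : Field.absoluteGaloisGroup K, g ∈ N' ↔
      ∀ x ∈ {x : ringClassField K ι (9 * p * ℓ) | (x : ℂ) ∈ ringClassField K ι (9 * p)},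
        (show AlgebraicClosure K ≃ₐ[K] AlgebraicClosure K from g) (emb x) = emb x)
    {c : ℚ} {z : ringClassField K ι (9 * p)} (hz : (z : ℂ) ^ 3 = (c : ℂ)) :
    ∀ h ∈ N', ∀ w : AlgebraicClosure K, w ^ 3 = algebraMap ℚ (AlgebraicClosure K) c →
      (show AlgebraicClosure K ≃ₐ[K] AlgebraicClosure K from h) w = w := by
  have hK := JZero.isImaginaryQuadratic_of_sq_add_self_add_one hω h2
  have hle := ringClassField_nine_mul_le hK ι hp0 hℓ0
  -- `emb₁ = emb ∘ (K[9p] ⊆ K[9pℓ])`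
  refine forall_apply_eq_of_coe_pow_three_eq hω h2 ι ((emb.comp (inclusion ι hle).toRingHom))
    (fun k ↦ ?_) N' (fun g hg x ↦ ?_) (z := z) hz
  · rw [RingHom.comp_apply, AlgHom.toRingHom_eq_coe, RingHom.coe_coe, AlgHom.commutes]
    exact hemb k
  · rw [RingHom.comp_apply, AlgHom.toRingHom_eq_coe, RingHom.coe_coe]
    exact (hN' g).mp hg _ (by
      show ((inclusion ι hle x : ringClassField K ι (9 * p * ℓ)) : ℂ) ∈ ringClassField K ι (9 * p)
      rw [coe_inclusion]; exact x.2)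

/-- **R0's `hN'c` for `E_p` (`b = p = 9c`, `c = p/9`)**: `N'` fixes every `w ∈ K̄` with `w³ = p/9`
(`∛(p/9) = ∛(3p)/3 ∈ K[9p] ⊇ L_{(3p)}`). [cite: HuShuYin2019, §2 Prop. 2.4 (1) and p. 8] -/
theorem forall_apply_eq_of_pow_three_eq_div_nine_of_fix_nine_mul {ω : K} (hω : ω ^ 2 + ω + 1 = 0)
    (h2 : Module.finrank ℚ K = 2) (ι : K →+* ℂ) {p ℓ : ℕ} (hp0 : p ≠ 0) (hℓ0 : ℓ ≠ 0)
    (emb : ringClassField K ι (9 * p * ℓ) →+* AlgebraicClosure K)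
    (hemb : ∀ k : K, emb (algebraMap K (ringClassField K ι (9 * p * ℓ)) k) =
      algebraMap K (AlgebraicClosure K) k)
    (N' : Subgroup (Field.absoluteGaloisGroup K))
    (hN' : ∀ g : Field.absoluteGaloisGroup K, g ∈ N' ↔
      ∀ x ∈ {x : ringClassField K ι (9 * p * ℓ) | (x : ℂ) ∈ ringClassField K ι (9 * p)},
        (show AlgebraicClosure K ≃ₐ[K] AlgebraicClosure K from g) (emb x) = emb x) :
    ∀ h ∈ N', ∀ w : AlgebraicClosure K, w ^ 3 = algebraMap ℚ (AlgebraicClosure K) ((p : ℚ) / 9) →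
      (show AlgebraicClosure K ≃ₐ[K] AlgebraicClosure K from h) w = w := by
  obtain ⟨r, hr⟩ := IsAlgClosed.exists_pow_nat_eq (3 * (p : ℂ)) (by norm_num : 0 < 3)
  have hrmem : r ∈ ringClassField K ι (9 * p) := by
    have h := cubeRoot_three_mul_mem_ringClassField hω h2 ι hp0 one_ne_zero r hr
    rwa [mul_one] at h
  have h3mem : (3 : ℂ) ∈ ringClassField K ι (9 * p) := by
    have h := apply_mem_ringClassField ι (9 * p) (3 : K)
    rwa [map_ofNat] at h
  refine forall_apply_eq_of_coe_pow_three_eq_of_fix_nine_mul hω h2 ι hp0 hℓ0 emb hemb N' hN'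
    (z := ⟨r / 3, div_mem hrmem h3mem⟩) (c := (p : ℚ) / 9) ?_
  show (r / 3) ^ 3 = (((p : ℚ) / 9 : ℚ) : ℂ)
  rw [div_pow, hr]
  push_cast
  ring

/-- **R0's `hN'c` for `E_{3p²}` (`b = 3p² = 9c`, `c = p²/3`)**: `N'` fixes every `w ∈ K̄` with
`w³ = p²/3` (`∛(p²/3) = (∛(3p))²/3 ∈ K[9p]`). [cite: HuShuYin2019, §2 Prop. 2.4 (1)] -/
theorem forall_apply_eq_of_pow_three_eq_sq_div_three_of_fix_nine_mul {ω : K} (hω : ω ^ 2 + ω + 1 = 0)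
    (h2 : Module.finrank ℚ K = 2) (ι : K →+* ℂ) {p ℓ : ℕ} (hp0 : p ≠ 0) (hℓ0 : ℓ ≠ 0)
    (emb : ringClassField K ι (9 * p * ℓ) →+* AlgebraicClosure K)
    (hemb : ∀ k : K, emb (algebraMap K (ringClassField K ι (9 * p * ℓ)) k) =
      algebraMap K (AlgebraicClosure K) k)
    (N' : Subgroup (Field.absoluteGaloisGroup K))
    (hN' : ∀ g : Field.absoluteGaloisGroup K, g ∈ N' ↔
      ∀ x ∈ {x : ringClassField K ι (9 * p * ℓ) | (x : ℂ) ∈ ringClassField K ι (9 * p)},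
        (show AlgebraicClosure K ≃ₐ[K] AlgebraicClosure K from g) (emb x) = emb x) :
    ∀ h ∈ N', ∀ w : AlgebraicClosure K, w ^ 3 = algebraMap ℚ (AlgebraicClosure K) ((p : ℚ) ^ 2 / 3) →
      (show AlgebraicClosure K ≃ₐ[K] AlgebraicClosure K from h) w = w := by
  obtain ⟨r, hr⟩ := IsAlgClosed.exists_pow_nat_eq (3 * (p : ℂ)) (by norm_num : 0 < 3)
  have hrmem : r ∈ ringClassField K ι (9 * p) := by
    have h := cubeRoot_three_mul_mem_ringClassField hω h2 ι hp0 one_ne_zero r hr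
    rwa [mul_one] at h
  have h3mem : (3 : ℂ) ∈ ringClassField K ι (9 * p) := by
    have h := apply_mem_ringClassField ι (9 * p) (3 : K)
    rwa [map_ofNat] at h
  refine forall_apply_eq_of_coe_pow_three_eq_of_fix_nine_mul hω h2 ι hp0 hℓ0 emb hemb N' hN'
    (z := ⟨r ^ 2 / 3, div_mem (pow_mem hrmem 2) h3mem⟩) (c := (p : ℚ) ^ 2 / 3) ?_
  show (r ^ 2 / 3) ^ 3 = (((p : ℚ) ^ 2 / 3 : ℚ) : ℂ)
  rw [div_pow, ← pow_mul, show 2 * 3 = 3 * 2 from rfl, pow_mul, hr]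
  push_cast
  ring

/-! ### `h6` at `m = 9pℓ` -/

/-- **R0's `h6` at the level `9pℓ`**: no `N`-fixed `z ∈ K̄` has `z³ = 6` (`N = Gal(K̄/emb K[9pℓ])`,
`p` and `ℓ` odd, `d_K = −3`): `K(∛6)/K` ramifies above `2`, `K[9pℓ]/K` does not — one call of
`pow_three_ne_six_of_forall_apply_eq`. [cite: GrossLMS1991, §4 Lemma 4.3] [cite: Cox2013, §9.A (p. 180)] -/
theorem pow_three_ne_six_of_fix_sylvester_prime (hK : IsImaginaryQuadratic K)
    (hdK : NumberField.discr K = -3) (ι : K →+* ℂ) {p ℓ : ℕ} (hp2 : Odd p) (hℓ2 : Odd ℓ)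
    (emb : ringClassField K ι (9 * p * ℓ) →+* AlgebraicClosure K)
    (hemb : ∀ k : K, emb (algebraMap K (ringClassField K ι (9 * p * ℓ)) k) =
      algebraMap K (AlgebraicClosure K) k)
    (N : Subgroup (Field.absoluteGaloisGroup K))
    (hN : ∀ g : Field.absoluteGaloisGroup K, g ∈ N ↔
      ∀ x : ringClassField K ι (9 * p * ℓ),
        (show AlgebraicClosure K ≃ₐ[K] AlgebraicClosure K from g) (emb x) = emb x) :
    ∀ z : AlgebraicClosure K,
      (∀ h ∈ N, (show AlgebraicClosure K ≃ₐ[K] AlgebraicClosure K from h) z = z) → z ^ 3 ≠ 6 :=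
  pow_three_ne_six_of_forall_apply_eq hK ι (by rw [hdK]; decide)
    ((show Odd 9 by decide).mul hp2 |>.mul hℓ2) emb hemb N hN

/-! ### `t/ht`: a transversal of `Γ_K/N'` -/

/-- **R0's `t/ht`**: for `N' ≤ Γ_K` the subgroup fixing `emb(K[9pℓ] ∩ K[9p])`, a FINITE system of
representatives `t : ι → Γ_K` of `Γ_K/N'` exists (lift a transversal of `Aut(K[9pℓ]/K) / Gal(K[9pℓ]/K[9p])`
along `emb`; `bijective_quotient_of_finite_level`).  Stated with `ι := Aut(K[9pℓ]/K) ⧸ H`.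
[cite: GrossLMS1991, §3 (3.3)–(3.4), §4 (4.1)] -/
theorem exists_transversal_quotient (hK : IsImaginaryQuadratic K) (ι : K →+* ℂ) {p ℓ : ℕ}
    (hp0 : p ≠ 0) (hℓ0 : ℓ ≠ 0)
    (emb : ringClassField K ι (9 * p * ℓ) →+* AlgebraicClosure K)
    (hemb : ∀ k : K, emb (algebraMap K (ringClassField K ι (9 * p * ℓ)) k) =
      algebraMap K (AlgebraicClosure K) k)
    (N' : Subgroup (Field.absoluteGaloisGroup K))
    (hN' : ∀ g : Field.absoluteGaloisGroup K, g ∈ N' ↔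
      ∀ x ∈ {x : ringClassField K ι (9 * p * ℓ) | (x : ℂ) ∈ ringClassField K ι (9 * p)},
        (show AlgebraicClosure K ≃ₐ[K] AlgebraicClosure K from g) (emb x) = emb x) :
    ∃ (n : ℕ) (t : Fin n → Field.absoluteGaloisGroup K),
      Function.Bijective fun i ↦ (t i : Field.absoluteGaloisGroup K ⧸ N') := by
  have hn0 : 9 * p * ℓ ≠ 0 := mul_ne_zero (mul_ne_zero (by norm_num) hp0) hℓ0
  haveI := (finiteDimensional_and_isGalois_ringClassField hK ι hn0).1
  haveI := (finiteDimensional_and_isGalois_ringClassField hK ι hn0).2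
  -- the finite-level subgroup `H = {σ | σ|_S = id}` (the fixing subgroup of `K[9pℓ] ∩ K[9p]`)
  have hHmem : ∀ σ : ringClassField K ι (9 * p * ℓ) ≃ₐ[K] ringClassField K ι (9 * p * ℓ),
      σ ∈ (subfieldIn ι (9 * p * ℓ) (9 * p)).fixingSubgroup ↔
        ∀ x ∈ {x : ringClassField K ι (9 * p * ℓ) | (x : ℂ) ∈ ringClassField K ι (9 * p)}, σ x = x :=
    fun σ ↦ by
    rw [IntermediateField.mem_fixingSubgroup_iff]
    exact ⟨fun h x hx ↦ h x ((mem_subfieldIn_iff ι _ _ x).mpr hx),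
      fun h x hx ↦ h x ((mem_subfieldIn_iff ι _ _ x).mp hx)⟩
  -- a transversal of `Aut(L/K)/H` (`Quotient.out`) and its lifts to `Γ_K`
  have hτ : Function.Bijective fun q : (ringClassField K ι (9 * p * ℓ) ≃ₐ[K] ringClassField K ι (9 * p * ℓ)) ⧸
      (subfieldIn ι (9 * p * ℓ) (9 * p)).fixingSubgroup ↦
        ((Quotient.out q : ringClassField K ι (9 * p * ℓ) ≃ₐ[K] ringClassField K ι (9 * p * ℓ)) :
          (ringClassField K ι (9 * p * ℓ) ≃ₐ[K] ringClassField K ι (9 * p * ℓ)) ⧸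
            (subfieldIn ι (9 * p * ℓ) (9 * p)).fixingSubgroup) := by
    have : (fun q : (ringClassField K ι (9 * p * ℓ) ≃ₐ[K] ringClassField K ι (9 * p * ℓ)) ⧸
        (subfieldIn ι (9 * p * ℓ) (9 * p)).fixingSubgroup ↦
        ((Quotient.out q : ringClassField K ι (9 * p * ℓ) ≃ₐ[K] ringClassField K ι (9 * p * ℓ)) :
          (ringClassField K ι (9 * p * ℓ) ≃ₐ[K] ringClassField K ι (9 * p * ℓ)) ⧸
            (subfieldIn ι (9 * p * ℓ) (9 * p)).fixingSubgroup)) = id := by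
      funext q; exact QuotientGroup.out_eq' q
    rw [this]; exact Function.bijective_id
  choose t ht using fun q : (ringClassField K ι (9 * p * ℓ) ≃ₐ[K] ringClassField K ι (9 * p * ℓ)) ⧸
      (subfieldIn ι (9 * p * ℓ) (9 * p)).fixingSubgroup ↦ exists_lift_algEquiv emb hemb (Quotient.out q)
  have hbij := bijective_quotient_of_finite_level emb hemb
    {x : ringClassField K ι (9 * p * ℓ) | (x : ℂ) ∈ ringClassField K ι (9 * p)} N' hN'
    (subfieldIn ι (9 * p * ℓ) (9 * p)).fixingSubgroup hHmem (fun q ↦ Quotient.out q) hτ t ht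
  -- reindex by `Fin n`
  obtain ⟨n, ⟨e⟩⟩ := Finite.exists_equiv_fin
    ((ringClassField K ι (9 * p * ℓ) ≃ₐ[K] ringClassField K ι (9 * p * ℓ)) ⧸
      (subfieldIn ι (9 * p * ℓ) (9 * p)).fixingSubgroup)
  exact ⟨n, t ∘ e.symm, hbij.comp e.symm.bijective⟩

/-! ### Transport along a `Γ_K`-equivariant `κ : E₉(K̄) ≃+ W(K̄)` -/

/-- **`hPN` transports along an equivariant isomorphism**: if `κ (g • P) = g • κ P` then
`Q ∈ W(K̄)^N ⇒ κ⁻¹ Q ∈ E₉(K̄)^N` (for the frame transport of k-ty1 #16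
`exists_frameTransport_cubeSumCurve_nine`, so that R0's `P` lives in `geomPoints ((cubeSumCurve 9).baseChange K)`).
[cite: SilvermanAEC2009, VIII.§1] -/
theorem mem_fixedPoints_symm_of_equivariant {W W' : WeierstrassCurve ℚ}
    (κ : geomPoints (W'.baseChange K) ≃+ geomPoints (W.baseChange K))
    (hκ : ∀ (g : Field.absoluteGaloisGroup K) (P : geomPoints (W'.baseChange K)), κ (g • P) = g • κ P)
    (N : Subgroup (Field.absoluteGaloisGroup K)) {Q : geomPoints (W.baseChange K)}
    (hQ : Q ∈ FixedPoints.addSubgroup N (geomPoints (W.baseChange K))) :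
    κ.symm Q ∈ FixedPoints.addSubgroup N (geomPoints (W'.baseChange K)) := by
  rw [JZero.mem_fixedPoints_iff] at hQ ⊢
  intro g hg
  apply κ.injective
  rw [hκ, κ.apply_symm_apply, hQ g hg]

/-- **`hP` transports along an equivariant isomorphism**: from `∃ a ∈ W(K̄)^N, m • a = h • Q − Q` to the
same for `κ⁻¹ Q` in `E₉(K̄)`. [cite: SilvermanAEC2009, VIII.§1] [cite: GrossLMS1991, §4 (4.1)] -/
theorem exists_fixedPoints_zsmul_eq_symm_of_equivariant {W W' : WeierstrassCurve ℚ}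
    (κ : geomPoints (W'.baseChange K) ≃+ geomPoints (W.baseChange K))
    (hκ : ∀ (g : Field.absoluteGaloisGroup K) (P : geomPoints (W'.baseChange K)), κ (g • P) = g • κ P)
    (N : Subgroup (Field.absoluteGaloisGroup K)) {Q : geomPoints (W.baseChange K)} {m : ℤ}
    {h : Field.absoluteGaloisGroup K}
    (hQ : ∃ a ∈ FixedPoints.addSubgroup N (geomPoints (W.baseChange K)), m • a = h • Q - Q) :
    ∃ a ∈ FixedPoints.addSubgroup N (geomPoints (W'.baseChange K)),
      m • a = h • κ.symm Q - κ.symm Q := by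
  obtain ⟨a, ha, hma⟩ := hQ
  refine ⟨κ.symm a, mem_fixedPoints_symm_of_equivariant κ hκ N ha, ?_⟩
  apply κ.injective
  rw [map_zsmul, κ.apply_symm_apply, hma, map_sub, hκ, κ.apply_symm_apply]

end Summit.BirchSwinnertonDyer.BirchSwinnertonDyer.Theorems.SylvesterTwoCMData

end
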